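import Literature.Computability.AlgebraicComplexity.PerDetHwvCertificateNineNine
import Literature.Computability.AlgebraicComplexity.PlethysmLengthVanishing
import HarnessLib

/-!
# The least degree of an equation of `Ω₃ = \overline{GL₉ · det₃}`: one Lean statement modulo the two
# remaining inputs (the det-side number `sk((9,9,2⁶), 3×10) = 0` and the degree-9 census)

Topic `Literature/Computability/AlgebraicComplexity` (geometric complexity theory); proofs file
(theorems only: no definitions, no named facts). Honest framing of the cell served (`pub-gct`,
papers/PneNP/gct-obstructions): rung-1 multiplicity-obstruction search for permanent versus
determinant at small `(n, m)`; no claim about VP ≠ VNP or P ≠ NP.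

Inputs already in the tree: the kernel-checked per-side certificate
`cert992_bound : 1 ≤ mult_{λ₀^*} ℂ[Δ(per₃)]₁₀`, `λ₀ = (9,9,2,2,2,2,2,2) ⊢ 30`
(`PerDetHwvCertificateNineNine.lean`); `mult ≤ a` (`orbitMultiplicity_le_plethysmCoeff_holds`,
BLMW 2011 §4.4); `sk < a ⇒` a highest-weight EQUATION of `Δ(det_m)`
(`exists_hwv_mem_orbitVanishingIdeal_det_of_symKroneckerCoeffRect_lt`, Bürgisser–Ikenmeyer 2013
(5.2)); the degree criterion and degree monotonicity (`PlethysmLengthVanishing.lean` §5–§7).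

* `one_le_plethysmCoeff_cert992` — `a_{λ₀}(10[3]) ≥ 1`, by the kernel certificate (no engine).
* `exists_hwv_mem_orbitVanishingIdeal_detThree_cert992_of_sk_eq_zero` — **if
  `sk(λ₀, 3×10) = 0` then `Ω₃` has a nonzero highest-weight equation of type `λ₀` (degree 10)**.
* `exists_ne_zero_mem_orbitVanishingIdeal_detThree_iff_ten_le` — **if moreover every type
  `λ ⊢ 27` with `ℓ(λ) ≤ 9` is full on the determinant side in degree 9 (the Tranche-1c degree-9
  census, `a_λ ≤ mult_{λ^*} ℂ[Ω₃]`), then for every `d`: `I(Ω₃)` has a nonzero homogeneous element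
  of degree `d` iff `10 ≤ d`** — "the least degree of an equation of `Ω₃` is exactly 10".

The two hypotheses are exactly the cell's remaining non-Lean inputs (the number `sk = 0` of two
engines of record; the 797-row census); nothing else is assumed.

## References

* P. Bürgisser, C. Ikenmeyer, *Explicit lower bounds via geometric complexity theory*, STOC 2013,
  §5 (5.1)–(5.2). [BurgisserIkenmeyer2013]
* C. Ikenmeyer, *Geometric complexity theory, tensor rank, and Littlewood–Richardson
  coefficients*, PhD thesis, Paderborn 2012, App. A.1 (the three types at `d = 10`).
  [Ikenmeyer2012Thesis]
* P. Bürgisser, J. M. Landsberg, L. Manivel, J. Weyman, SIAM J. Comput. 40 (2011) §4.4,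
  Prop. 5.2.1. [BLMW2011]
-/

noncomputable section

open MvPolynomial

namespace Literature.Computability.AlgebraicComplexity

open _root_.Literature.NumberTheory.DiophantineGeometry
open TableauEval

/-- `λ₀ = (9,9,2⁶)` has `8 ≤ 9` parts. [folklore] -/
theorem card_parts_lamPartition_cert992 :
    (cert992.lamPartition (cert992.lam_pos_of_verify cert992_verify)
        (cert992.lam_sum_of_verify cert992_verify)).parts.card ≤ 3 * 3 := by
  rw [Cert.card_lamPartition]
  decide

/-- **`a_{(9,9,2⁶)}(10[3]) ≥ 1` by kernel certificate**: `1 ≤ mult_{λ₀^*} ℂ[Δ(per₃)]₁₀`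
(`cert992_bound`) and `mult ≤ a` (BLMW 2011 §4.4, `orbitMultiplicity_le_plethysmCoeff_holds`).
[cite: BLMW2011, §4.4] -/
theorem one_le_plethysmCoeff_cert992 :
    1 ≤ plethysmCoeff ℂ (MatIdx 3) 3
      (cert992.weight (cert992.lam_pos_of_verify cert992_verify)
        (cert992.lam_sum_of_verify cert992_verify)) := by
  have h1 := cert992_bound
  have h2 := orbitMultiplicity_le_plethysmCoeff_holds (k := ℂ) (paddedPerFormLex ℂ 3 3)
    (m := 3) (by decide) (paddedPerFormLex_isHomogeneous ℂ le_rfl)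
    (cert992.weight (cert992.lam_pos_of_verify cert992_verify)
      (cert992.lam_sum_of_verify cert992_verify))
  exact le_trans h1 h2

/-- **If `sk((9,9,2⁶), 3×10) = 0`, the orbit closure `Ω₃` of `det₃` has a nonzero highest-weight
EQUATION of type `(9,9,2⁶)` in degree 10**: `sk = 0 < 1 ≤ a` (`one_le_plethysmCoeff_cert992`)
and Bürgisser–Ikenmeyer 2013 (5.2)
(`exists_hwv_mem_orbitVanishingIdeal_det_of_symKroneckerCoeffRect_lt`).
The hypothesis is the cell's det-side number (engines of record), not a Lean computation.
[cite: BurgisserIkenmeyer2013, §5 (5.2)] -/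
theorem exists_hwv_mem_orbitVanishingIdeal_detThree_cert992_of_sk_eq_zero
    (hsk : symKroneckerCoeffRect ℂ 3 10
      (cert992.lamPartition (cert992.lam_pos_of_verify cert992_verify)
        (cert992.lam_sum_of_verify cert992_verify)) = 0) :
    ∃ F : MvPolynomial (DegIdx (MatIdx 3) 3) ℂ, F ≠ 0 ∧
      F ∈ highestWeightSpace (coordRep (MatIdx 3) ℂ 3)
        (cert992.weight (cert992.lam_pos_of_verify cert992_verify)
          (cert992.lam_sum_of_verify cert992_verify)) ∧
      F ∈ orbitVanishingIdeal (detFormLex ℂ 3) 3 := by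
  have ha := one_le_plethysmCoeff_cert992
  exact exists_hwv_mem_orbitVanishingIdeal_det_of_symKroneckerCoeffRect_lt (k := ℂ) (m := 3)
    (d := 10) _ card_parts_lamPartition_cert992 (by rw [hsk]; exact ha)

/-- **"The least degree of a nonzero equation of `Ω₃` is exactly 10", as one Lean statement modulo
the cell's two remaining inputs**: (i) the degree-9 determinant-side census — every `λ ⊢ 27`
with `ℓ(λ) ≤ 9` is full, `a_λ ≤ mult_{λ^*} ℂ[Ω₃]` (797 rank cells of Tranche 1c; `ℓ ≤ 3` rows are
theorem rows); (ii) the number `sk((9,9,2⁶), 3×10) = 0`. Then for every `d`, `I(Ω₃)` contains a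
nonzero homogeneous polynomial of degree `d` iff `10 ≤ d` (degree criterion + degree monotonicity,
`exists_ne_zero_mem_orbitVanishingIdeal_det_iff_le_of_pred_of_symKroneckerCoeffRect_lt`, with the
per-side input `a ≥ 1` kernel-checked, `one_le_plethysmCoeff_cert992`).
[cite: BurgisserIkenmeyer2013, §5 (5.1)–(5.2)] -/
theorem exists_ne_zero_mem_orbitVanishingIdeal_detThree_iff_ten_le
    (H9 : ∀ lam : Nat.Partition (3 * (10 - 1)), lam.parts.card ≤ 3 * 3 → lam.parts.card ≤ 10 - 1 →
      plethysmCoeff ℂ (MatIdx 3) 3 (Weight.dualOfPartition (3 * 3) lam).toMatIdx ≤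
        orbitMultiplicity ℂ (detFormLex ℂ 3) 3 (Weight.dualOfPartition (3 * 3) lam).toMatIdx)
    (hsk : symKroneckerCoeffRect ℂ 3 10
      (cert992.lamPartition (cert992.lam_pos_of_verify cert992_verify)
        (cert992.lam_sum_of_verify cert992_verify)) = 0)
    (d : ℕ) :
    (∃ Ψ ∈ orbitVanishingIdeal (detFormLex ℂ 3) 3, Ψ ≠ 0 ∧ Ψ.IsHomogeneous d) ↔ 10 ≤ d := by
  have ha := one_le_plethysmCoeff_cert992
  exact exists_ne_zero_mem_orbitVanishingIdeal_det_iff_le_of_pred_of_symKroneckerCoeffRect_lt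
    (k := ℂ) (m := 3) (D := 10) H9 _ card_parts_lamPartition_cert992 (by rw [hsk]; exact ha) d

end Literature.Computability.AlgebraicComplexity
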